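import Summits.ResolutionOfSingularities.ResolutionOfSingularities.Theorems.LossEntryW25
import HarnessLib

/-!
# LossEntryW28 — decomp-res lens-3 g29 «LossEntryWalk», landing part 28 (slice 20): the wall-state pencil law in the
DEGENERATE in-wall position (in-wall slice a pure power of the chart letter)

Residual `stmt-ResolutionOfSingularities-27367`.  Imports part 25 only; independent of parts 12–24, 26, 27.
The pencil family `φ₀·(u_c − μ u_b)^s` of `LossEntryW25` misses one in-wall line: `u_b = 0`, i.e. the in-wall slice
`φ₀·u_b^s`, `b` the chart letter of the move.  This part treats it:

* `resForm_eq_axis_of_wall_axis` — one-wall state `u` (boundary `M·e_a`, shade `s`, order `s+M > q`), chart `b ≠ a`,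
  shade plateau, `b_u(a) ≠ 0`, in-wall slice of the lowest layer `= φ₀·u_b^s` ⟹
  `resForm W u (s+M) = C (φ₀/(−b_u(a))^s) · u_a^s` (the lowest layer of `F_u` is `φ₀/(−b_u(a))^s · u_a^M·(u_a − b_u(a) u_b)^s`);
* `wall_axis_succ` — hence the next state's in-wall slice (wall `u_b`) is `U_u(0)·φ₀/(−b_u(a))^s · u_a^s`: root `0`
  in the frame `(b; c, a)`, or again the degenerate position if the next chart is `a`.

Same engine as part 25 (`cone_of_plateau` + `eq_zero_of_translate_axis`).  Tree tools only; complete proofs, standard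
axioms.

(Sources: Hauser2010 §F; HauserPerlega2019 §2; CossartJannsenSaito2020 Ch. 8; Moh1987; Perlega2022.)
-/

open MvPolynomial Finset
open Literature.AlgebraicGeometry.Resolution
open Literature.AlgebraicGeometry.Resolution.Hauser2010
open Literature.AlgebraicGeometry.Resolution.PointBlowup
open Summit.ResolutionOfSingularities.ResolutionOfSingularities.Theorems.TightDefectClasses
open Summit.ResolutionOfSingularities.ResolutionOfSingularities.Theorems.TightDefectStrongWalks
open Summit.ResolutionOfSingularities.ResolutionOfSingularities.Theorems.ItineraryCutClasses
open Summit.ResolutionOfSingularities.ResolutionOfSingularities.Theorems.BoundaryLedger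
open Summit.ResolutionOfSingularities.ResolutionOfSingularities.Theorems.ProximityCut
open Summit.ResolutionOfSingularities.ResolutionOfSingularities.Theorems.ConeCut
open Summit.ResolutionOfSingularities.ResolutionOfSingularities.Theorems.LossExitCone

namespace Summit.ResolutionOfSingularities.ResolutionOfSingularities.Theorems.LossPolygon

section WallAxisPosition

variable {K : Type} [Field K] [DecidableEq K] {q : ℕ} {s₀ : State (Fin 3) K}

/-- **WALL-STATE PENCIL LAW, DEGENERATE POSITION — residual form (PROVED).**  See the module docstring.
[new] [folklore] -/
theorem resForm_eq_axis_of_wall_axis (hroot : IsRoot q s₀) (W : ForcedWalk q s₀) (u : ℕ) {a b c : Fin 3}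
    (hab : a ≠ b) (hac : a ≠ c) (hbc : b ≠ c) (hj : W.j u = b) {M s : ℕ}
    (hr : (W.st u).r = Finsupp.single a M) (hsh : (W.st u).shade = (s : ℕ∞))
    (hplat : (W.st (u + 1)).shade = (W.st u).shade) (hq : q < s + M) (hga : W.b u a ≠ 0) {φ₀ : K}
    (hwall : ∀ E : Fin 3 →₀ ℕ, E.degree = s → E a = 0 →
      coeff ((W.st u).r + E) (W.st u).F = φ₀ * coeff E (X b ^ s)) :
    ordZero (W.st u).F = ((s + M : ℕ) : ℕ∞) ∧
      resForm W u (s + M) = C (φ₀ / (-W.b u a) ^ s) * X a ^ s := by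
  classical
  obtain ⟨o, ho, -⟩ := walk_nat hroot W u
  obtain ⟨n, hn, hon⟩ := order_eq_shade_add_degree hroot W u ho
  have hns : n = s := by
    have h := hsh
    rw [hn] at h
    exact_mod_cast h
  subst hns
  have hrdeg : (W.st u).r.degree = M := by rw [hr, Finsupp.degree_single]
  rw [hrdeg] at hon
  subst hon
  refine ⟨ho, ?_⟩
  have hqo : q < n + M := hq
  have hcone := (cone_of_plateau hroot W u ho hqo hplat hn).1
  have hgan : (-W.b u a) ^ n ≠ 0 := pow_ne_zero _ (neg_ne_zero.mpr hga)
  set φ' : K := φ₀ / (-W.b u a) ^ n with hφ'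
  have hφ'φ : φ' * (-W.b u a) ^ n = φ₀ := by rw [hφ', div_mul_cancel₀ _ hgan]
  rw [X_pow_eq_monomial, C_mul_monomial, mul_one]
  set Q : MvPolynomial (Fin 3) K := monomial (Finsupp.single a n) φ' with hQ
  have hQhom : Q.IsHomogeneous n := by
    rw [hQ]
    exact isHomogeneous_monomial _ (by rw [Finsupp.degree_single])
  have hDhom : (resForm W u (n + M) - Q).IsHomogeneous n := hcone.sub hQhom
  have hDb : ∀ E ∈ (resForm W u (n + M) - Q).support, E b = 0 := by
    intro E hE
    by_contra hEb
    apply MvPolynomial.mem_support_iff.mp hE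
    rw [coeff_sub, coeff_resForm_eq_zero W u _ (by rw [hj]; exact hEb), zero_sub, neg_eq_zero, hQ,
      coeff_monomial, if_neg]
    intro h
    apply hEb
    rw [← h, Finsupp.single_eq_of_ne hab.symm]
  have hax : ∀ i : ℕ, i ≤ n →
      coeff (Finsupp.single c i) (translate (-W.b u) (resForm W u (n + M) - Q)) = 0 := by
    intro i hi
    have hL : translate (-W.b u) (resForm W u (n + M)) = resLayer (W.j u) (W.st u) (n + M) := by
      unfold resForm
      rw [LossExitCone.translate_translate, neg_add_cancel, PointBlowup.translate_zero]
    set m : Fin 3 →₀ ℕ := Finsupp.single c i + Finsupp.single b (n - i) with hm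
    have hmdeg : m.degree = n := by
      rw [hm, map_add, Finsupp.degree_single, Finsupp.degree_single]
      omega
    have hma : m a = 0 := by
      rw [hm, Finsupp.add_apply, Finsupp.single_eq_of_ne hac, Finsupp.single_eq_of_ne hab, add_zero]
    have hupd : m.update b 0 = Finsupp.single c i := by
      ext w
      rw [Finsupp.update_apply]
      by_cases hwb : w = b
      · rw [if_pos hwb, hwb, Finsupp.single_eq_of_ne hbc]
      · rw [if_neg hwb, hm, Finsupp.add_apply, Finsupp.single_eq_of_ne (a := b) hwb, add_zero]
    -- the in-wall coefficient: `φ₀` at `i = 0`, else `0`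
    have hLc : coeff (Finsupp.single c i) (resLayer (W.j u) (W.st u) (n + M)) = if i = 0 then φ₀ else 0 := by
      rw [← hupd, hj, coeff_resLayer b (W.st u) (walk_r hroot W u) (n + M) m (by rw [hmdeg, hrdeg]),
        hwall m hmdeg hma, X_pow_eq_monomial, coeff_monomial]
      by_cases hi0 : i = 0
      · rw [if_pos, if_pos hi0, mul_one]
        rw [hm, hi0, Finsupp.single_zero, zero_add, Nat.sub_zero]
      · rw [if_neg, if_neg hi0, mul_zero]
        intro h
        apply hi0
        have := congrArg (fun E : Fin 3 →₀ ℕ => E c) h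
        rw [hm, Finsupp.add_apply, Finsupp.single_eq_same, Finsupp.single_eq_of_ne (Ne.symm hbc),
          Finsupp.single_eq_of_ne (Ne.symm hbc), add_zero] at this
        exact this.symm
    -- the comparison monomial: `φ'·(−g_a)^n` at `i = 0`, else `0`
    have hQc : coeff (Finsupp.single c i) (translate (-W.b u) Q) = if i = 0 then φ₀ else 0 := by
      rw [hQ, WeightedBlowup.coeff_translate_monomial, prod_univ_fin3 hab hac hbc, Finsupp.single_eq_same,
        Finsupp.single_eq_of_ne hac, Finsupp.single_eq_of_ne (Ne.symm hab), Finsupp.single_eq_of_ne hbc,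
        Finsupp.single_eq_of_ne (Ne.symm hac), Finsupp.single_eq_same, Pi.neg_apply, Nat.choose_zero_right,
        Nat.sub_zero, Nat.cast_one, one_mul]
      by_cases hi0 : i = 0
      · rw [if_pos hi0, hi0]
        simp only [Nat.choose_self, Nat.sub_zero, pow_zero, Nat.cast_one, mul_one]
        rw [hφ'φ]
      · rw [if_neg hi0, Nat.choose_eq_zero_of_lt (Nat.pos_of_ne_zero hi0), Nat.cast_zero, zero_mul, mul_zero,
          mul_zero]
    rw [translate_sub, coeff_sub, hL, hLc, hQc, sub_self]
  have hD0 := eq_zero_of_translate_axis hab hac hbc hDhom hDb (-W.b u)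
    (by rw [Pi.neg_apply, neg_ne_zero]; exact hga) hax
  rw [sub_eq_zero, hQ] at hD0
  exact hD0

/-- **WALL-STATE PENCIL LAW, DEGENERATE POSITION — the next in-wall slice (PROVED).**  Under the hypotheses of
`resForm_eq_axis_of_wall_axis`: `coeff_{r_{u+1}+m} F_{u+1} = U_u(0)·φ₀/(−b_u(a))^s · coeff_m (u_a^s)` for `|m| = s`,
`m b = 0` (`ConeCut.restriction_of_plateau`). [new] [folklore] -/
theorem wall_axis_succ (hroot : IsRoot q s₀) (W : ForcedWalk q s₀) (u : ℕ) {a b c : Fin 3}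
    (hab : a ≠ b) (hac : a ≠ c) (hbc : b ≠ c) (hj : W.j u = b) {M s : ℕ}
    (hr : (W.st u).r = Finsupp.single a M) (hsh : (W.st u).shade = (s : ℕ∞))
    (hplat : (W.st (u + 1)).shade = (W.st u).shade) (hq : q < s + M) (hga : W.b u a ≠ 0) {φ₀ : K}
    (hwall : ∀ E : Fin 3 →₀ ℕ, E.degree = s → E a = 0 →
      coeff ((W.st u).r + E) (W.st u).F = φ₀ * coeff E (X b ^ s))
    (m : Fin 3 →₀ ℕ) (hmb : m b = 0) (hm : m.degree = s) :
    coeff ((W.st (u + 1)).r + m) (W.st (u + 1)).F =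
      (bUnit W u * (φ₀ / (-W.b u a) ^ s)) * coeff m (X a ^ s) := by
  obtain ⟨ho, hres⟩ := resForm_eq_axis_of_wall_axis hroot W u hab hac hbc hj hr hsh hplat hq hga hwall
  rw [restriction_of_plateau hroot W u ho (by exact_mod_cast hq) hplat hsh m (by rw [hj]; exact hmb) hm, hres,
    coeff_C_mul, mul_assoc]

end WallAxisPosition

end Summit.ResolutionOfSingularities.ResolutionOfSingularities.Theorems.LossPolygon
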